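import Summits.HubbardSuperconductivity.HubbardSuperconductivity.Theorems.JosephsonMirrorJmPairBridgeGenericCoupling
import Summits.HubbardSuperconductivity.HubbardSuperconductivity.Theorems.BalabanIRBirEveryGroundStatePencil
import HarnessLib

/-!
# Crux `JmPairBridge` (stmt-HubbardSuperconductivity-2226), line `schur-rigid-bridge`:
# irreducibility of the floor is constant between consecutive exceptional couplings

Route `JosephsonMirror`, crux `JmPairBridge`. Consequence of `irreducibilityLocallyConstant`
(`Theorems/JosephsonMirrorJmPairBridgeGenericCoupling.lean`) for the line's spectral residue
(`stub_irreducibleFloorDense`: density of space-group-irreducible couplings): at a fixed torus side `L` and particle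
number `N`, space-group irreducibility of the `(N, 0)` ground floor of `hubbardTorus 2 L 1 U` is CONSTANT along every
preconnected set of non-exceptional couplings (`irreducible_const_on_preconnected`: a locally constant Boolean on a
preconnected set is constant), and the exceptional couplings — those where the number of distinct eigenvalues is not
maximal — form a FINITE set (`exists_finset_forall_card_roots_le`, Hermite–Sylvester), so irreducibility is constant
on each of the finitely many open intervals they cut out of the coupling axis
(`exists_finset_irreducible_const`). Hence the density residue is decided, at each fixed `L`, by ONE coupling per
interval — the finite-computation form in which a refuter can test it.

Sources: T. Kato, *Perturbation Theory for Linear Operators* (1966), Ch. II §§1.1, 5.1; J.-P. Serre, *Linear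
Representations of Finite Groups* §2.2. No definition, no named fact.
-/

noncomputable section

-- the mandated namespace `Summit.<Summit>.<Problem>.Theorems` repeats `HubbardSuperconductivity`
-- (single-problem summit, D-0017), which the `dupNamespace` linter flags on every declaration
set_option linter.dupNamespace false

namespace Summit.HubbardSuperconductivity.HubbardSuperconductivity.Theorems.JosephsonMirror

open Matrix Literature.MathematicalPhysics.QuantumLattice Literature.Probability.LatticeModels
open scoped ComplexOrder

/-- **Irreducibility of the floor is constant along preconnected sets of non-exceptional couplings.** For the
torus side `L`, a particle number `N` and a preconnected set `S` of couplings at each of which the number of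
distinct eigenvalues of `hubbardTorus 2 L 1 U` is maximal, the `(N, 0)` ground floor is space-group irreducible at
one coupling of `S` iff it is at every coupling of `S` (the Boolean "irreducible at `u`" is locally constant on
`S` by `irreducibilityLocallyConstant`, hence continuous into the discrete space `Bool`, hence constant on the
preconnected `S`). Kato (1966) II §5.1; Serre §2.2. [folklore] -/
theorem irreducible_const_on_preconnected (L : ℕ) [NeZero L] (N : ℕ) (S : Set ℝ) (hS : IsPreconnected S)
    (hgen : ∀ U ∈ S, ∀ u' : ℝ, (hubbardTorus 2 L 1 u').charpoly.roots.toFinset.card ≤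
      (hubbardTorus 2 L 1 U).charpoly.roots.toFinset.card) :
    ∀ U ∈ S, ∀ U' ∈ S,
      ((∀ K' : Submodule ℂ (Fock (Orb (FermionTorus 2 L))),
        K' ≤ szSector N 0 ⊓ Module.End.eigenspace (Matrix.toLin' (hubbardTorus 2 L 1 U))
            (((hubbardTorus 2 L 1 U).minEnergyOn (szSector N 0) : ℝ) : ℂ) →
        (∀ (γ : DihedralGroup 4) (v : TorusSite 2 L), ∀ w ∈ K',
          ((fockD4 γ).val * (fockTranslate v).val) *ᵥ w ∈ K') →
        K' = ⊥ ∨ K' = szSector N 0 ⊓ Module.End.eigenspace (Matrix.toLin' (hubbardTorus 2 L 1 U))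
            (((hubbardTorus 2 L 1 U).minEnergyOn (szSector N 0) : ℝ) : ℂ)) ↔
      (∀ K' : Submodule ℂ (Fock (Orb (FermionTorus 2 L))),
        K' ≤ szSector N 0 ⊓ Module.End.eigenspace (Matrix.toLin' (hubbardTorus 2 L 1 U'))
            (((hubbardTorus 2 L 1 U').minEnergyOn (szSector N 0) : ℝ) : ℂ) →
        (∀ (γ : DihedralGroup 4) (v : TorusSite 2 L), ∀ w ∈ K',
          ((fockD4 γ).val * (fockTranslate v).val) *ᵥ w ∈ K') →
        K' = ⊥ ∨ K' = szSector N 0 ⊓ Module.End.eigenspace (Matrix.toLin' (hubbardTorus 2 L 1 U'))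
            (((hubbardTorus 2 L 1 U').minEnergyOn (szSector N 0) : ℝ) : ℂ))) := by
  classical
  -- irreducibility as a Boolean function of the coupling
  let f : ℝ → Bool := fun u => decide
    (∀ K' : Submodule ℂ (Fock (Orb (FermionTorus 2 L))),
        K' ≤ szSector N 0 ⊓ Module.End.eigenspace (Matrix.toLin' (hubbardTorus 2 L 1 u))
            (((hubbardTorus 2 L 1 u).minEnergyOn (szSector N 0) : ℝ) : ℂ) →
        (∀ (γ : DihedralGroup 4) (v : TorusSite 2 L), ∀ w ∈ K',
          ((fockD4 γ).val * (fockTranslate v).val) *ᵥ w ∈ K') →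
        K' = ⊥ ∨ K' = szSector N 0 ⊓ Module.End.eigenspace (Matrix.toLin' (hubbardTorus 2 L 1 u))
            (((hubbardTorus 2 L 1 u).minEnergyOn (szSector N 0) : ℝ) : ℂ))
  have hf : ContinuousOn f S := by
    intro U hU
    obtain ⟨ε, hε, hloc⟩ := irreducibilityLocallyConstant L N U (hgen U hU)
    have hev : f =ᶠ[nhds U] fun _ => f U := by
      filter_upwards [Ioo_mem_nhds (show U - ε < U by linarith) (show U < U + ε by linarith)] with u hu
      exact decide_eq_decide.2 (hloc u hu)
    exact hev.continuousAt.continuousWithinAt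
  intro U hU U' hU'
  have h : f U = f U' := hS.constant hf hU hU'
  exact decide_eq_decide.1 h

/-- **One coupling per interval decides irreducibility.** At a fixed torus side `L` and particle number `N` there is
a FINITE set `E` of exceptional couplings (Hermite–Sylvester: `exists_finset_forall_card_roots_le` for the affine
Hermitian pencil `hubbardTorus 2 L 1 U = H₀ + U · Σ_x n_x↑ n_x↓`) such that along every preconnected set of
couplings avoiding `E` — in particular on each open interval between consecutive exceptional couplings — the
`(N, 0)` ground floor is space-group irreducible either everywhere or nowhere. Kato (1966) II §§1.1, 5.1. [folklore] -/
theorem exists_finset_irreducible_const (L : ℕ) [NeZero L] (N : ℕ) :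
    ∃ E : Finset ℝ, ∀ S : Set ℝ, IsPreconnected S → (∀ u ∈ S, u ∉ E) →
      ∀ U ∈ S, ∀ U' ∈ S,
        ((∀ K' : Submodule ℂ (Fock (Orb (FermionTorus 2 L))),
        K' ≤ szSector N 0 ⊓ Module.End.eigenspace (Matrix.toLin' (hubbardTorus 2 L 1 U))
            (((hubbardTorus 2 L 1 U).minEnergyOn (szSector N 0) : ℝ) : ℂ) →
        (∀ (γ : DihedralGroup 4) (v : TorusSite 2 L), ∀ w ∈ K',
          ((fockD4 γ).val * (fockTranslate v).val) *ᵥ w ∈ K') →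
        K' = ⊥ ∨ K' = szSector N 0 ⊓ Module.End.eigenspace (Matrix.toLin' (hubbardTorus 2 L 1 U))
            (((hubbardTorus 2 L 1 U).minEnergyOn (szSector N 0) : ℝ) : ℂ)) ↔
        (∀ K' : Submodule ℂ (Fock (Orb (FermionTorus 2 L))),
        K' ≤ szSector N 0 ⊓ Module.End.eigenspace (Matrix.toLin' (hubbardTorus 2 L 1 U'))
            (((hubbardTorus 2 L 1 U').minEnergyOn (szSector N 0) : ℝ) : ℂ) →
        (∀ (γ : DihedralGroup 4) (v : TorusSite 2 L), ∀ w ∈ K',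
          ((fockD4 γ).val * (fockTranslate v).val) *ᵥ w ∈ K') →
        K' = ⊥ ∨ K' = szSector N 0 ⊓ Module.End.eigenspace (Matrix.toLin' (hubbardTorus 2 L 1 U'))
            (((hubbardTorus 2 L 1 U').minEnergyOn (szSector N 0) : ℝ) : ℂ))) := by
  have hpen : ∀ u : ℝ, hubbardTorus 2 L 1 u = hubbardTorus 2 L 1 0 +
      ((u : ℝ) : ℂ) • ∑ x : FermionTorus 2 L, numberOp x 0 * numberOp x 1 := fun u =>
    hamiltonian_eq_add_smul_doublon (fermionTorusGraph 2 L) 1 u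
  have hT : (hubbardTorus 2 L 1 0).IsHermitian := LiebThm1.hamiltonian_isHermitian (fermionTorusGraph 2 L) 1 0
  have hD : (∑ x : FermionTorus 2 L, numberOp x 0 * numberOp x 1 :
      Matrix (Finset (Orb (FermionTorus 2 L))) (Finset (Orb (FermionTorus 2 L))) ℂ).IsHermitian :=
    doublon_isHermitian
  obtain ⟨E, hE⟩ := exists_finset_forall_card_roots_le hT hD
  refine ⟨E, fun S hS hSE => irreducible_const_on_preconnected L N S hS fun U hU u' => ?_⟩
  rw [hpen u', hpen U]
  exact hE U (hSE U hU) u'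

end Summit.HubbardSuperconductivity.HubbardSuperconductivity.Theorems.JosephsonMirror

end
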